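import Summits.CriticalPhenomena.PercolationContinuityZ3.Theorems.PercNearOneGluingNoHeavyLowerTailKernelTools
import HarnessLib

/-!
# `NoHeavyLowerTail` (stmt-CriticalPhenomena-4575) — corners of the `2+2` kernel in forced-star coordinates (I):
# evaluation of forced-star margins and the SURE-HAIR (ARC) corner

Support file (lemma factory `prim-lf-3` gen 7, seat g9; `--supports stmt-CriticalPhenomena-4575`).  No definitions, no
named facts, no sorries.  Memo: `run/shared/lean/prim/prim-lf-3/LF3-BETA-R.md` §8 (assembly, corners).

`K` is a core in which the observer `o` is isolated (`K s(o,u) = 0`); for a pattern `T` the FORCED STAR is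
`W_T := (f ↦ if f ∈ T.image (s(o,·)) then 1 else K f)` and `Gf(T) := μ_{W_T}(o ↔ b) − μ_{W_T}(j ↔ b)` (abstracted as a function `G` with
hypothesis `hG`).
* `forcedMargin_eq` — `Gf(T) = μ_{K[S↦1]}(t₀ ↔ b) − μ_{K[S↦1]}(j ↔ b)` for any set `S` of sure pairs inside `T` that joins `t₀` to every `t ∈ T` directly or
  through one hub (`real_openConn_forcedStar_eq`).
* `arcCorner` — the sure-hair corner: a two-port unit touching `c` surely and `d` with probability `u`, against a unit of ARBITRARY law `ν` on the
  subsets of `Q`: from the split row of `c`,  `Σ_S ν_S [(1−u)·Gf(S+c) + u·Gf(S+c+d)] ≥ 0`  (`unitGlue_general` on the base `K` with the pair `s(c,d)` raised by `u`).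
-/

namespace Summit.CriticalPhenomena.PercolationContinuityZ3.Theorems

open MeasureTheory Set ProbabilityTheory
open Literature.Probability.LatticeModels
open Literature.Probability.Percolation

noncomputable section
open Classical

namespace UpsetExchange

variable {n : ℕ}

/-- **Evaluation of a forced-star margin** through sure pairs inside the pattern. [folklore] -/
theorem forcedMargin_eq (K : Sym2 (Fin n) → unitInterval) (o b j : Fin n)
    (hisoK : ∀ u : Fin n, u ≠ o → K s(o, u) = 0) (hbo : b ≠ o) (hjo : j ≠ o)
    (T : Finset (Fin n)) (hoT : o ∉ T) (t₀ : Fin n) (ht₀ : t₀ ∈ T)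
    (S : Finset (Sym2 (Fin n))) (hS : ∀ e ∈ S, ∀ x ∈ e, x ∈ T)
    (hreach : ∀ t ∈ T, t = t₀ ∨ s(t₀, t) ∈ S ∨ ∃ m : Fin n, m ≠ t₀ ∧ m ≠ t ∧ s(m, t₀) ∈ S ∧ s(m, t) ∈ S) :
    (prodBernoulli (fun f : Sym2 (Fin n) => if f ∈ T.image (fun t => s(o, t)) then 1 else K f)).real (openConn o b) -
        (prodBernoulli (fun f : Sym2 (Fin n) => if f ∈ T.image (fun t => s(o, t)) then 1 else K f)).real (openConn j b) =
      (prodBernoulli (fun f : Sym2 (Fin n) => if f ∈ S then 1 else K f)).real (openConn t₀ b) -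
        (prodBernoulli (fun f : Sym2 (Fin n) => if f ∈ S then 1 else K f)).real (openConn j b) := by
  set KS : Sym2 (Fin n) → unitInterval := fun f => if f ∈ S then 1 else K f with hKS
  have hconn : ∀ t ∈ T, (prodBernoulli KS).real (openConn t₀ t)ᶜ = 0 := by
    intro t ht
    rcases hreach t ht with rfl | hdir | ⟨m, hm0, hmt, h1, h2⟩
    · have : ((openConn t t)ᶜ : Set (BondConfig (Fin n))) = ∅ := by
        ext ω; simp only [mem_compl_iff, mem_empty_iff_false, iff_false, not_not]
        exact (SimpleGraph.Reachable.refl t : (openGraph ω).Reachable t t)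
      rw [this, measureReal_empty]
    · by_cases htt : t₀ = t
      · subst htt
        have : ((openConn t₀ t₀)ᶜ : Set (BondConfig (Fin n))) = ∅ := by
          ext ω; simp only [mem_compl_iff, mem_empty_iff_false, iff_false, not_not]
          exact (SimpleGraph.Reachable.refl t₀ : (openGraph ω).Reachable t₀ t₀)
        rw [this, measureReal_empty]
      · exact real_not_openConn_eq_zero_of_surePair KS t₀ t htt (by simp [hKS, hdir])
    · exact real_not_openConn_eq_zero_of_hub KS m t₀ t hm0.symm hmt.symm (by simp [hKS, h1]) (by simp [hKS, h2])
  have h := real_openConn_forcedStar_eq K o hisoK T hoT t₀ ht₀ S hS hconn j b hbo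
  have h' := real_openConn_forcedStar_eq K o hisoK T hoT t₀ ht₀ S hS hconn o b hbo
  rw [h.1 hjo, h'.2]

/-- The clique pairs of `insert c S` joined with one extra pair lie inside the enlarged pattern. [folklore] -/
theorem cliquePairs_mem_inside (T : Finset (Fin n)) :
    ∀ e ∈ Finset.univ.filter (fun e : Sym2 (Fin n) => (∀ x ∈ e, x ∈ T) ∧ ¬ e.IsDiag), ∀ x ∈ e, x ∈ T := by
  intro e he x hx
  exact (Finset.mem_filter.1 he).2.1 x hx

/-- **The sure-hair (ARC) corner.**  See the module docstring. [cite: KozmaNitzan2024, Lemma 5 (p. 13), Question 9 (p. 36)] -/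
theorem arcCorner (K : Sym2 (Fin n) → unitInterval) (o c d j b : Fin n) (Q : Finset (Fin n))
    (ν : Finset (Fin n) → ℝ) (hν : ∀ S ∈ Q.powerset, 0 ≤ ν S) (u : unitInterval)
    (hoQ : o ∉ Q) (hcQ : c ∉ Q) (hdQ : d ∉ Q) (hcd : c ≠ d) (hoc : o ≠ c) (hod : o ≠ d) (hjo : j ≠ o) (hbo : b ≠ o)
    (hisoK : ∀ u' : Fin n, u' ≠ o → K s(o, u') = 0)
    (G : Finset (Fin n) → ℝ)
    (hG : ∀ T : Finset (Fin n), G T =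
      (prodBernoulli (fun f : Sym2 (Fin n) => if f ∈ T.image (fun t => s(o, t)) then 1 else K f)).real (openConn o b) -
        (prodBernoulli (fun f : Sym2 (Fin n) => if f ∈ T.image (fun t => s(o, t)) then 1 else K f)).real (openConn j b))
    (hrow : 0 ≤ ∑ S ∈ Q.powerset, ν S *
      ((1 - (u : ℝ)) * ((prodBernoulli (fun e : Sym2 (Fin n) => if (∀ x ∈ e, x ∈ S) ∧ ¬ e.IsDiag then 1 else K e)).real (openConn c b) -
          (prodBernoulli (fun e : Sym2 (Fin n) => if (∀ x ∈ e, x ∈ S) ∧ ¬ e.IsDiag then 1 else K e)).real (openConn j b)) +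
        (u : ℝ) * ((prodBernoulli (fun f : Sym2 (Fin n) => if f = s(c, d) then 1 else
              (if (∀ x ∈ f, x ∈ S) ∧ ¬ f.IsDiag then 1 else K f))).real (openConn c b) -
          (prodBernoulli (fun f : Sym2 (Fin n) => if f = s(c, d) then 1 else
              (if (∀ x ∈ f, x ∈ S) ∧ ¬ f.IsDiag then 1 else K f))).real (openConn j b)))) :
    0 ≤ ∑ S ∈ Q.powerset, ν S * ((1 - (u : ℝ)) * G (insert c S) + (u : ℝ) * G (insert d (insert c S))) := by
  set e : Sym2 (Fin n) := s(c, d) with he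
  -- the base with the pair `e` raised by `u`
  set Ku : Sym2 (Fin n) → unitInterval := fun f => if f = e then Set.Icc.convexComb (K e) 1 u else K f with hKu
  -- key identity: gluing a set `S` with `d ∉ S` commutes with raising `e`, and splits by `real_raisePair_eq_mix`
  have hsplit : ∀ (S : Finset (Fin n)), d ∉ S → ∀ z : Fin n,
      (prodBernoulli (fun f : Sym2 (Fin n) => if (∀ x ∈ f, x ∈ S) ∧ ¬ f.IsDiag then 1 else Ku f)).real (openConn z b) =
        (1 - (u : ℝ)) * (prodBernoulli (fun f : Sym2 (Fin n) => if (∀ x ∈ f, x ∈ S) ∧ ¬ f.IsDiag then 1 else K f)).real (openConn z b) +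
        (u : ℝ) * (prodBernoulli (fun f : Sym2 (Fin n) => if f = e then 1 else
              (if (∀ x ∈ f, x ∈ S) ∧ ¬ f.IsDiag then 1 else K f))).real (openConn z b) := by
    intro S hdS z
    set gS : Sym2 (Fin n) → unitInterval := fun f => if (∀ x ∈ f, x ∈ S) ∧ ¬ f.IsDiag then 1 else K f with hgS
    have heS : ¬ ((∀ x ∈ e, x ∈ S) ∧ ¬ e.IsDiag) := fun h => hdS (h.1 d (by rw [he]; exact Sym2.mem_mk_right c d))
    have hfun : (fun f : Sym2 (Fin n) => if (∀ x ∈ f, x ∈ S) ∧ ¬ f.IsDiag then (1 : unitInterval) else Ku f) =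
        fun f => if f = e then Set.Icc.convexComb (gS e) 1 u else gS f := by
      funext f
      by_cases hf : f = e
      · rw [hf, if_neg heS]; simp only [hKu, hgS, if_true, if_neg heS]
      · simp only [hKu, hgS, if_neg hf]
    rw [hfun, real_raisePair_eq_mix gS e u (openConn z b)]
  -- hypothesis of `unitGlue_general` for the base `Ku`
  have hcS : ∀ S ∈ Q.powerset, c ∉ S := fun S hS h => hcQ (Finset.mem_powerset.1 hS h)
  have hdS : ∀ S ∈ Q.powerset, d ∉ S := fun S hS h => hdQ (Finset.mem_powerset.1 hS h)
  have hyp' : 0 ≤ ∑ S ∈ Q.powerset, ν S *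
      ((prodBernoulli (fun f : Sym2 (Fin n) => if (∀ x ∈ f, x ∈ S) ∧ ¬ f.IsDiag then 1 else Ku f)).real (openConn c b) -
        (prodBernoulli (fun f : Sym2 (Fin n) => if (∀ x ∈ f, x ∈ S) ∧ ¬ f.IsDiag then 1 else Ku f)).real (openConn j b)) := by
    refine le_of_le_of_eq hrow (Finset.sum_congr rfl fun S hS => ?_)
    rw [hsplit S (hdS S hS) c, hsplit S (hdS S hS) j]
    ring
  set s₀ : Finset (Fin n) → Fin n := fun S => if h : S.Nonempty then h.choose else c with hs₀
  have hs₀' : ∀ S ∈ Q.powerset, S.Nonempty → s₀ S ∈ S := by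
    intro S _ h; simp only [hs₀, dif_pos h]; exact h.choose_spec
  have key := unitGlue_general Ku c j b Q.powerset ν hν hcS s₀ hs₀' hyp'
  -- conclusion of `unitGlue_general` converted to forced-star margins
  refine le_of_le_of_eq key (Finset.sum_congr rfl fun S hS => ?_)
  have hSQ : S ⊆ Q := Finset.mem_powerset.1 hS
  have hcS' := hcS S hS
  have hdS' := hdS S hS
  have hdcS : d ∉ insert c S := by
    rw [Finset.mem_insert]; rintro (h | h); exact hcd h.symm; exact hdS' h
  rw [hsplit (insert c S) hdcS c, hsplit (insert c S) hdcS j]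
  -- (a) clique of `insert c S` ↦ `G (insert c S)`
  set T₁ : Finset (Fin n) := insert c S with hT₁
  set C₁ : Finset (Sym2 (Fin n)) := Finset.univ.filter (fun f : Sym2 (Fin n) => (∀ x ∈ f, x ∈ T₁) ∧ ¬ f.IsDiag) with hC₁
  have hoT₁ : o ∉ T₁ := by
    rw [hT₁, Finset.mem_insert]; rintro (h | h); exact hoc h; exact hoQ (hSQ h)
  have hcT₁ : c ∈ T₁ := Finset.mem_insert_self _ _
  have hreach₁ : ∀ t ∈ T₁, t = c ∨ s(c, t) ∈ C₁ ∨ ∃ m : Fin n, m ≠ c ∧ m ≠ t ∧ s(m, c) ∈ C₁ ∧ s(m, t) ∈ C₁ := by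
    intro t ht
    by_cases htc : t = c
    · exact Or.inl htc
    · refine Or.inr (Or.inl (Finset.mem_filter.2 ⟨Finset.mem_univ _, ?_, ?_⟩))
      · intro x hx; rcases Sym2.mem_iff.1 hx with rfl | rfl; exact hcT₁; exact ht
      · rw [Sym2.mk_isDiag_iff]; exact fun h => htc h.symm
  have hG₁ := forcedMargin_eq K o b j hisoK hbo hjo T₁ hoT₁ c hcT₁ C₁ (cliquePairs_mem_inside T₁) hreach₁
  -- (b) clique of `insert c S` plus the pair `e` ↦ `G (insert d (insert c S))`
  set T₂ : Finset (Fin n) := insert d T₁ with hT₂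
  set C₂ : Finset (Sym2 (Fin n)) := insert e C₁ with hC₂
  have hoT₂ : o ∉ T₂ := by
    rw [hT₂, Finset.mem_insert]; rintro (h | h); exact hod h; exact hoT₁ h
  have hcT₂ : c ∈ T₂ := Finset.mem_insert_of_mem hcT₁
  have hC₂in : ∀ f ∈ C₂, ∀ x ∈ f, x ∈ T₂ := by
    intro f hf x hx
    rw [hC₂, Finset.mem_insert] at hf
    rcases hf with rfl | hf
    · rcases Sym2.mem_iff.1 hx with rfl | rfl
      · exact hcT₂
      · exact Finset.mem_insert_self _ _
    · exact Finset.mem_insert_of_mem (cliquePairs_mem_inside T₁ f hf x hx)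
  have hreach₂ : ∀ t ∈ T₂, t = c ∨ s(c, t) ∈ C₂ ∨ ∃ m : Fin n, m ≠ c ∧ m ≠ t ∧ s(m, c) ∈ C₂ ∧ s(m, t) ∈ C₂ := by
    intro t ht
    rw [hT₂, Finset.mem_insert] at ht
    rcases ht with rfl | ht
    · exact Or.inr (Or.inl (by rw [hC₂]; exact Finset.mem_insert_self _ _))
    · rcases hreach₁ t ht with h | h | ⟨m, h1, h2, h3, h4⟩
      · exact Or.inl h
      · exact Or.inr (Or.inl (Finset.mem_insert_of_mem h))
      · exact Or.inr (Or.inr ⟨m, h1, h2, Finset.mem_insert_of_mem h3, Finset.mem_insert_of_mem h4⟩)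
  have hG₂ := forcedMargin_eq K o b j hisoK hbo hjo T₂ hoT₂ c hcT₂ C₂ hC₂in hreach₂
  -- identify the weightings
  have hf₁ : (fun f : Sym2 (Fin n) => if (∀ x ∈ f, x ∈ T₁) ∧ ¬ f.IsDiag then (1 : unitInterval) else K f) =
      fun f => if f ∈ C₁ then 1 else K f := glueClique_eq_memForm K T₁
  have hf₂ : (fun f : Sym2 (Fin n) => if f = e then (1 : unitInterval) else (if (∀ x ∈ f, x ∈ T₁) ∧ ¬ f.IsDiag then 1 else K f)) =
      fun f => if f ∈ C₂ then 1 else K f := by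
    funext f
    by_cases hfe : f = e
    · have h2 : f ∈ C₂ := by rw [hC₂, hfe]; exact Finset.mem_insert_self _ _
      rw [if_pos hfe, if_pos h2]
    · rw [if_neg hfe]
      by_cases h1 : f ∈ C₁
      · have h2 : f ∈ C₂ := by rw [hC₂]; exact Finset.mem_insert_of_mem h1
        rw [if_pos h2, congrFun (glueClique_eq_memForm K T₁) f]
        exact if_pos h1
      · have h2 : f ∉ C₂ := by
          rw [hC₂]; intro h
          rcases Finset.mem_insert.1 h with h | h
          · exact hfe h
          · exact h1 h
        rw [if_neg h2, congrFun (glueClique_eq_memForm K T₁) f]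
        exact if_neg h1
  rw [hG T₁, hG T₂, hG₁, hG₂, ← hf₁, ← hf₂]
  ring

end UpsetExchange

end

end Summit.CriticalPhenomena.PercolationContinuityZ3.Theorems
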